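import Mathlib
import HarnessLib
import Summits.AtomisticToContinuum.Crystallization.Theses.TwoCentreKissingKernel

/-!
# Route TwoCentreKissingKernel — the Assembly item (stmt-AtomisticToContinuum-12085)

`Assembly := TwoCentreFourCommon → GapFreeShellRigidity → BondOrderTwelve → BondToShells →
ClosePackedCrystallizes → CrysPeriodicMinAttained → CrysEnergyLimit → Crystallization` is the
informal shape of the route's deciding theorem `closes`; its proof is that theorem's body: pure
logic over the seven antecedents plus the identification `⨅ = e(P)` for a least element
(`IsLeast.csInf_eq`). `TwoCentreFourCommon` heads the chain as the route's kill switch and is not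
consumed by the proof term (exactly as in `closes`).
-/

namespace Summit.AtomisticToContinuum.Crystallization.Theorems

open Summit.AtomisticToContinuum.Crystallization.Theses.TwoCentreKissingKernel
open Literature.MathematicalPhysics.StatisticalMechanics

/-- **Assembly of route TwoCentreKissingKernel** (item stmt-AtomisticToContinuum-12085): the glue
`BondToShells` turns `BondOrderTwelve` and the kernel `GapFreeShellRigidity` into the target
`LocalClosePacking`; the hinge `ClosePackedCrystallizes` gives the positional conjunct
`IsCrystallizing lennardJones 3`; `CrysPeriodicMinAttained` supplies a least-energy periodic
configuration `P`, so `⨅_Q e(Q) = e(P)` (`IsLeast.csInf_eq`) and `CrysEnergyLimit` is exactly the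
limit statement `E(N)/N → e(P)` of `HasPeriodicGroundStateEnergy lennardJones 3`; the pair of
conjuncts is `_root_.Crystallization` by definition. `TwoCentreFourCommon` (Flatley–Theil's
Conjecture 2.2) is a hypothesis not used by the proof term, as in the route's `closes`. -/
theorem twoCentreKissingKernel_assembly_proof :
    Summit.AtomisticToContinuum.Crystallization.Theses.TwoCentreKissingKernel.Assembly := by
  unfold Summit.AtomisticToContinuum.Crystallization.Theses.TwoCentreKissingKernel.Assembly
  intro _h_TwoCentreFourCommon h_GapFreeShellRigidity h_BondOrderTwelve h_BondToShells
    h_ClosePackedCrystallizes h_CrysPeriodicMinAttained h_CrysEnergyLimit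
  -- (1) the route target: bond order + the gap-free kernel ⇒ local close packing
  have hLCP : LocalClosePacking := h_BondToShells h_BondOrderTwelve h_GapFreeShellRigidity
  -- (2) positional conjunct (ii): the hinge
  have hpos : IsCrystallizing lennardJones 3 := h_ClosePackedCrystallizes hLCP
  -- (3) energetic conjunct (i): a least periodic configuration P, ⨅ = e(P), and E(N)/N → e(P)
  obtain ⟨P, hleast⟩ := h_CrysPeriodicMinAttained
  have hinf : (⨅ Q : PeriodicConfiguration 3, Q.energyPerParticle lennardJones) =
      P.energyPerParticle lennardJones := hleast.csInf_eq
  have hlim : Filter.Tendsto (fun N : ℕ => groundStateEnergy lennardJones 3 N / N) Filter.atTop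
      (nhds (P.energyPerParticle lennardJones)) := by
    have h0 : CrysEnergyLimit := h_CrysEnergyLimit
    unfold CrysEnergyLimit at h0
    rw [hinf] at h0
    exact h0
  exact ⟨⟨P, hleast, hlim⟩, hpos⟩

end Summit.AtomisticToContinuum.Crystallization.Theorems
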